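import Summits.HodgeConjecture.HodgeConjecture.Theorems.R90S7RigidCoreDefs                    -- ★ p862183 `R90.S7.QsRigidCore` (the letter this junction proves, in hypothesis form)
import Summits.HodgeConjecture.HodgeConjecture.Theorems.R90S5MemXiFamilyUniqOfAEComponents     -- ★ p865279 (S5 (H34)) U♭-variant `R90.S5.memXiFamily_of_memXiFamily_of_eventually_eq_qsRecordSCD_πn`
import Summits.HodgeConjecture.HodgeConjecture.Theorems.R90S5ScPartnerUniqueSigned               -- ★ p861393 `R90.S5.eq_of_charIdentityAtTestSigned` (uniqueness of the SIGNED supercuspidal partner under (T_v))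
import Summits.HodgeConjecture.HodgeConjecture.Theorems.F0P3FinRepConstituentsExist              -- ★ `isConstituentOf_finRepSmooth_comp_of_hasFinComponent` (σ-constituent ⇒ `P.finRep.smoothPart`-constituent)
import Literature.NumberTheory.Rogawski1990.CharIdentityOnTestFunctionsSignedLemmas             -- ★ `CMNonsplitCharIdentityAtTestSigned.πs` ∕ `.charIdentityAtTestSigned_πs`
import Literature.NumberTheory.Rogawski1990.LocalTransferExistence                             -- ★ (H₇) `IsLocalDeltaTransferExists`
import Literature.NumberTheory.Automorphic.CMFieldNonsplitPlacesInfinite                        -- ★ (this seat) `infinite_setOf_forall_placesOver_complexConj_smul_eq` (a CM field has infinitely many non-split places)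
import HarnessLib

/-!
# R90-TF · S7 (Ch. 14.6-tuple, C146) · JQ-S7-C1 «`qsRigidCore_of_S5`» — S7's letter `QsRigidCore L` (Thm. 13.3.6 (c) + 13.3.5 on `U(Φ₃)`, finite part, at print's
# PINNED data) FROM S5's two print sockets (QS-R♯) ∕ (QS-T) BY TYPE, the SIGNED package «Q♯@Φ₃» and transfer existence «(T_v)@Φ₃» — ★ plumbing, Lines-free
# ([Rogawski1990, §13.3 Thm. 13.3.5, Thm. 13.3.6 (c) p. 202; §13.1 Prop. 13.1.3 (d), Prop. 13.1.4 p. 199; §12.2 (2) pp. 173–174; §4.9 Prop. 4.9.1 (a) p. 55])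

Cell `hodgecm-mathlib`, crux H413 (`stmt-HodgeConjecture-24833`), route of record `HCCMUnconditional`; programme R90-TF (brief `director/R90-BRIEF.v2.md`
1f40d54518340a35), section S7 = Rogawski §14.6 (base `R90-C146`), seat R90-C146-p01 (g3); S7 pen LH7-plan (g5) RULING S7-R23 (1) «BOOKED JQ-S7-C1 `qsRigidCore_of_S5`»
+ (3) DEAL D-S7#15 (probe `R90/R90-C146-p01/g3/jqC1/QsRigidCore_JunctionProbe.v1.lean` abdddb92102b8f07 GREEN by path, census `CENSUS-D-S7-15-…` d7c70823a5eb6319).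
Helper file, lane `--supports stmt-HodgeConjecture-24833 --as helper`; ONE theorem; no `def`, no instance, no notation, no `sorry`; `Theorems` + `Literature` imports
only (a `Theorems` file never imports `Cruxes/…/Lines/`, so S5's two socket TYPES are RESTATED as the binder types of `hRig` ∕ `hAe` — the bodies of
`R90.S5.SocketQsXiRigiditySharp` (S5 D `Lines/R90_S5_QuasiSplitRigidityD.lean` ED. 5 v3 a27b7cdb28f5b7c9 :275–:342) and `R90.S5.SocketQsFiniteTriggerMembership` (:432–:456)
BYTE FOR BYTE; S7 file C ED. 3 feeds `stub_R90_1335_qsXiRigiditySharp` ∕ `stub_R90_1336c_qsFinMembership` BY NAME, Lean unfolding the two `def`s).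

THE STATEMENT.  `qsRigidCore_of_S5 hRig hAe hQ3 hT3 : ∀ L, QsRigidCore L` with FOUR named hypotheses:
* `hRig` — (QS-R♯) «13.3.5 ∕ 13.3.6 rigidity on `U(Φ₃)`, sharp»: every `v`-constituent of an envelope member `P` (`MemXiFamily P … ξ`) at a non-split `v` is `πⁿ(ξ_v) ∘ e` or the
  `πˢ` of the signed package `hQS` [Thm. 13.3.5 + Prop. 13.1.3 (d)] — S5's socket TYPE;
* `hAe` — (QS-T) «13.3.6 (c) finite trigger»: a `πⁿ(ξ_v) ∘ e`-constituent at ONE non-split `v` puts `P` in SOME envelope `MemXiFamily P … ξ′` [Thm. 13.3.6 (c)] — S5's socket TYPE;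
* `hQ3` «Q♯@Φ₃» — the SIGNED CM character-identity package `CMCharIdentityPackageTestSigned L (qsForm L) …` on the quasi-split group at print's data [Prop. 13.1.4 non-split;
  §4.13 Lemma 4.13.1 (b) ∕ 13.1.4 split] (the `hQS` binder of (QS-R♯) is universally quantified INSIDE the socket, so a caller must SUPPLY a package; `QsRigidCore`'s pinned
  datum `(hSC, hSCid)` is matched against it by ★ partner uniqueness);
* `hT3` «(T_v)@Φ₃» — local Δ‴-transfer EXISTENCE at the non-split places on `U(Φ₃)` [Prop. 4.9.1 (a)] (= the `hex` binder of (QS-R♯); R90 floor (E1), RULING S7-R14 (b)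
  «the PAYER consumes that floor by name» — consumed HERE);
the binder prefix of `hQ3` ∕ `hT3` is (QS-R♯)'s :275–:317 BYTE FOR BYTE.  The third residue of the probe, «INF-NONSPLIT», is DISCHARGED: ★ `infinite_setOf_forall_placesOver_complexConj_smul_eq`
(this seat, `Literature/NumberTheory/Automorphic/CMFieldNonsplitPlacesInfinite.lean`).

THE PROOF ([Rogawski1990 §13.3 p. 202] read in the tree's currency; every step ★).  `QsRigidCore`'s occurrence hypothesis (★ `cmOccursInDiscreteSpectrum_iff`) yields a discrete
`P` with an irreducible admissible finite component `σ` whose family of local classes is `π`; each `π_v` is a constituent of `P` at `v` (★ `isConstituentOf_finRepSmooth_comp_of_hasFinComponent`).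
The a.e. hypothesis holds off a finite set, which misses a NON-SPLIT `v₀` (★ INF-NONSPLIT); the record at `v₀` is `⟨πⁿ(ξ_{v₀}) ∘ e, some πˢ⟩` (★ `xiPacketFamilyOfRecordSCD_of_nonsplit`),
so `π_{v₀} = πⁿ ∘ e` triggers (QS-T): `MemXiFamily P … ξ′`; the ★ U♭-variant (p865279) re-labels it to `MemXiFamily P … ξ`.  At a SPLIT `v` the family's packet is the singleton
split packet at `splitWitness v hs` (★ `IsXiLocalFamily` split pin) = the record (★ `xiPacketFamilyOfRecordSCD_of_split`), and ★ `LocalAPacket.mem_members_iff` is the letter's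
disjunction.  At a NON-SPLIT `v`, (QS-R♯) at the record's frame `(T, a)` and Keys labels of record gives `π_v = πⁿ ∘ e` (first disjunct, `rw` along the record) or `π_v =` the
`πˢ` of `hQ3 … ξ`; the latter and `QsRigidCore`'s pinned `(hSC …).1` both complete `πⁿ ∘ e` in the SIGNED [13.1.4] on test functions (★ `charIdentityAtTestSigned_πs` resp. the
binder `hSCid`) with the same sign `±1 ≠ 0`, so they are EQUAL (★ `R90.S5.eq_of_charIdentityAtTestSigned`, transfer exists by `hT3`).  The `cmDatum` ∕ `adelicGroupData` spellings of
`U(Φ₃)`'s adelic datum are definitionally equal (one `haveI`).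

HONEST LABEL: a junction theorem closes no citation; it converts S7's letter `QsRigidCore` (socket `stub_R90_S7_qsRigidCore` of S7 file C) into {S5's two print sockets (QS-R♯), (QS-T)
+ «Q♯@Φ₃» (print, S3-owned by content) + «(T_v)@Φ₃» (print, floor (E1))}; REL ≠ ★ ≠ BUILT.  HC_CM is proved only modulo the 7 printed citations (2 remaining named inputs:
hLiu418 = stmt-HodgeConjecture-24832, h413 = stmt-HodgeConjecture-24833) — until rung 0 closes.

## References
* [Rogawski1990] J. D. Rogawski, *Automorphic Representations of Unitary Groups in Three Variables*, Ann. of Math. Stud. 123 (1990): §13.3 Thm. 13.3.5,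
  Thm. 13.3.6 (c) p. 202, Thm. 13.3.7 p. 203; §13.1 Prop. 13.1.3 (d), Prop. 13.1.4 p. 199; §12.2 (2) pp. 173–174; §4.9 Prop. 4.9.1 (a) p. 55; §4.13 Lemma 4.13.1 (b) pp. 64–66;
  §14.6 p. 242, Thm. 14.6.4 p. 244.
* [LanglandsShelstad1987] R. P. Langlands, D. Shelstad, *On the definition of transfer factors*, Math. Ann. 278 (1987), §1.
* [Marcus2018] D. A. Marcus, *Number Fields*, 2nd ed. (2018), Ch. 7 Thm. 43.
-/

set_option autoImplicit false
-- the mandated namespace repeats the single-problem summit's segment (`HodgeConjecture.HodgeConjecture`)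
set_option linter.dupNamespace false

noncomputable section

open NumberField IsDedekindDomain MeasureTheory Filter
open scoped Matrix ComplexOrder

open Literature.NumberTheory Literature.NumberTheory.Automorphic Literature.NumberTheory.Automorphic.UnitaryGroup
open Literature.NumberTheory.Automorphic.IdeleClassGroup
open Literature.NumberTheory.GaloisRepresentations
open Literature.NumberTheory.Rogawski1990
open Summit.HodgeConjecture.HodgeConjecture.Cruxes.H413
open Summit.HodgeConjecture.HodgeConjecture.Cruxes.H413.F0P3XiPacketFamilyOfRecord (keysOfKeysCaseTwo)
open Summit.HodgeConjecture.HodgeConjecture.Cruxes.H413.F0P3XiPacketFamilyOfRecordSCD (xiPacketFamilyOfRecordSCD xiPacketFamilyOfRecordSCD_of_split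
  xiPacketFamilyOfRecordSCD_of_nonsplit)
open Summit.HodgeConjecture.HodgeConjecture.Cruxes.H413.F0P3FinRepConstituentsExist (isConstituentOf_finRepSmooth_comp_of_hasFinComponent)
open Summit.HodgeConjecture.HodgeConjecture.Cruxes.H413.F0P3GlobalPacketDiscrete (cmOccursInDiscreteSpectrum cmOccursInDiscreteSpectrum_iff)

namespace Summit.HodgeConjecture.HodgeConjecture.R90.S7

open scoped Classical in
set_option synthInstance.maxHeartbeats 400000 in
set_option maxHeartbeats 8000000 in
/-- **JQ-S7-C1 «`qsRigidCore_of_S5`»: S7's letter `QsRigidCore L` — Thm. 13.3.6 (c) + 13.3.5 on the quasi-split `U(Φ₃)`, finite part, at print's PINNED data — at EVERY CM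
field `L`, from FOUR named hypotheses**: `hRig` = the TYPE of S5's (QS-R♯) socket `stub_R90_1335_qsXiRigiditySharp` («every `v`-constituent of a `ξ`-envelope member at a non-split
`v` is `πⁿ(ξ_v) ∘ e` or the signed package's `πˢ`», Thm. 13.3.5 + Prop. 13.1.3 (d)); `hAe` = the TYPE of S5's (QS-T) socket `stub_R90_1336c_qsFinMembership` («a `πⁿ(ξ_v) ∘ e`-constituent
at one non-split `v` puts `P` in some envelope», Thm. 13.3.6 (c)); `hQ3` «Q♯@Φ₃» = the SIGNED CM character-identity package on `U(Φ₃)` at print's data (Prop. 13.1.4, Lemma 4.13.1 (b));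
`hT3` «(T_v)@Φ₃» = local Δ‴-transfer existence at the non-split places (Prop. 4.9.1 (a); R90 floor (E1)).  Proof: occurrence ⇒ `(P, σ, π)`; a non-split trigger place in the
a.e. set (★ `infinite_setOf_forall_placesOver_complexConj_smul_eq`); (QS-T) + ★ U♭-variant p865279 ⇒ `MemXiFamily P … ξ`; split `v`: singleton split packet = record; non-split `v`:
(QS-R♯) at the record's frame and Keys labels, then ★ partner uniqueness `R90.S5.eq_of_charIdentityAtTestSigned` between `hQ3`'s `πˢ` and the pinned datum `(hSC, hSCid)`.
[cite: Rogawski1990, §13.3 Thm. 13.3.5, Thm. 13.3.6 (c) p. 202; §13.1 Prop. 13.1.3 (d), Prop. 13.1.4 p. 199; §12.2 (2) pp. 173–174; §4.9 Prop. 4.9.1 (a) p. 55; §4.13 Lemma 4.13.1 (b) pp. 64–66]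
[cite: LanglandsShelstad1987, §1] [cite: Marcus2018, Ch. 7 Thm. 43] -/
theorem qsRigidCore_of_S5
    -- (R-rig) the TYPE of S5's socket (QS-R♯) `R90.S5.stub_R90_1335_qsXiRigiditySharp` = body of `R90.S5.SocketQsXiRigiditySharp` (S5 D :275–:342) BYTE FOR BYTE
    (hRig :
      ∀ (L : Type) [Field L] [NumberField L] [IsCMField L]
        [∀ v : HeightOneSpectrum (𝓞 ↥(maximalRealSubfield L)), MeasurableSpace ((cmDatum L 3 (qsForm L)).Local v)]
        [∀ v : HeightOneSpectrum (𝓞 ↥(maximalRealSubfield L)),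
          MeasurableSpace ((cmDatum L 2 (Matrix.of fun i j : Fin 2 => if i.val + j.val + 1 = 2 then (1 : L) else 0)).Local v ×
            (cmDatum L 1 (Matrix.of fun i j : Fin 1 => if i.val + j.val + 1 = 1 then (1 : L) else 0)).Local v)]
        [∀ (v : HeightOneSpectrum (𝓞 ↥(maximalRealSubfield L)))
            (a : ((cmDatum L 2 (Matrix.of fun i j : Fin 2 => if i.val + j.val + 1 = 2 then (1 : L) else 0)).Local v ×
              (cmDatum L 1 (Matrix.of fun i j : Fin 1 => if i.val + j.val + 1 = 1 then (1 : L) else 0)).Local v)),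
          MeasurableSpace (((cmDatum L 2 (Matrix.of fun i j : Fin 2 => if i.val + j.val + 1 = 2 then (1 : L) else 0)).Local v ×
              (cmDatum L 1 (Matrix.of fun i j : Fin 1 => if i.val + j.val + 1 = 1 then (1 : L) else 0)).Local v) ⧸
            Subgroup.centralizer ({a} : Set ((cmDatum L 2 (Matrix.of fun i j : Fin 2 => if i.val + j.val + 1 = 2 then (1 : L) else 0)).Local v ×
              (cmDatum L 1 (Matrix.of fun i j : Fin 1 => if i.val + j.val + 1 = 1 then (1 : L) else 0)).Local v)))]
        [∀ (v : HeightOneSpectrum (𝓞 ↥(maximalRealSubfield L))) (γ : (cmDatum L 3 (qsForm L)).Local v),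
          MeasurableSpace ((cmDatum L 3 (qsForm L)).Local v ⧸ Subgroup.centralizer ({γ} : Set ((cmDatum L 3 (qsForm L)).Local v)))]
        (Δ : ∀ v : HeightOneSpectrum (𝓞 ↥(maximalRealSubfield L)), LocalTransferFactor L (qsForm L) v)
        (mH : ∀ v : HeightOneSpectrum (𝓞 ↥(maximalRealSubfield L)),
          OrbitalMeasureFamily ((cmDatum L 2 (Matrix.of fun i j : Fin 2 => if i.val + j.val + 1 = 2 then (1 : L) else 0)).Local v ×
            (cmDatum L 1 (Matrix.of fun i j : Fin 1 => if i.val + j.val + 1 = 1 then (1 : L) else 0)).Local v))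
        (mG : ∀ v : HeightOneSpectrum (𝓞 ↥(maximalRealSubfield L)), OrbitalMeasureFamily ((cmDatum L 3 (qsForm L)).Local v))
        (νG : ∀ v : HeightOneSpectrum (𝓞 ↥(maximalRealSubfield L)), Measure ((cmDatum L 3 (qsForm L)).Local v))
        (νH : ∀ v : HeightOneSpectrum (𝓞 ↥(maximalRealSubfield L)),
          Measure ((cmDatum L 2 (Matrix.of fun i j : Fin 2 => if i.val + j.val + 1 = 2 then (1 : L) else 0)).Local v ×
            (cmDatum L 1 (Matrix.of fun i j : Fin 1 => if i.val + j.val + 1 = 1 then (1 : L) else 0)).Local v))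
        [∀ v : HeightOneSpectrum (𝓞 ↥(maximalRealSubfield L)), BorelSpace ((cmDatum L 3 (qsForm L)).Local v)]
        [∀ v : HeightOneSpectrum (𝓞 ↥(maximalRealSubfield L)),
          BorelSpace ((cmDatum L 2 (Matrix.of fun i j : Fin 2 => if i.val + j.val + 1 = 2 then (1 : L) else 0)).Local v ×
            (cmDatum L 1 (Matrix.of fun i j : Fin 1 => if i.val + j.val + 1 = 1 then (1 : L) else 0)).Local v)]
        [∀ (v : HeightOneSpectrum (𝓞 ↥(maximalRealSubfield L)))
            (a : ((cmDatum L 2 (Matrix.of fun i j : Fin 2 => if i.val + j.val + 1 = 2 then (1 : L) else 0)).Local v ×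
              (cmDatum L 1 (Matrix.of fun i j : Fin 1 => if i.val + j.val + 1 = 1 then (1 : L) else 0)).Local v)),
          BorelSpace (((cmDatum L 2 (Matrix.of fun i j : Fin 2 => if i.val + j.val + 1 = 2 then (1 : L) else 0)).Local v ×
              (cmDatum L 1 (Matrix.of fun i j : Fin 1 => if i.val + j.val + 1 = 1 then (1 : L) else 0)).Local v) ⧸
            Subgroup.centralizer ({a} : Set ((cmDatum L 2 (Matrix.of fun i j : Fin 2 => if i.val + j.val + 1 = 2 then (1 : L) else 0)).Local v ×
              (cmDatum L 1 (Matrix.of fun i j : Fin 1 => if i.val + j.val + 1 = 1 then (1 : L) else 0)).Local v)))]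
        [∀ (v : HeightOneSpectrum (𝓞 ↥(maximalRealSubfield L))) (γ : (cmDatum L 3 (qsForm L)).Local v),
          BorelSpace ((cmDatum L 3 (qsForm L)).Local v ⧸ Subgroup.centralizer ({γ} : Set ((cmDatum L 3 (qsForm L)).Local v)))]
        [∀ v, (νG v).IsHaarMeasure] [∀ v, (νG v).IsMulRightInvariant] [∀ v, (νH v).IsHaarMeasure] [∀ v, (νH v).IsMulRightInvariant],
        ∀ (μω : HeckeCharacter L) (hμu : μω.IsUnitary),
        (∀ x : Literature.NumberTheory.GaloisRepresentations.ideleGroup ↥(maximalRealSubfield L),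
          μω (AdeleRing.ideleBaseChange (↥(maximalRealSubfield L)) L x) = quadraticHeckeCharCM L x) →
        Δ = finExplicitCollection L (qsForm L) μω (finExplicitDelta_conj_left_all L (qsForm L) μω) (finExplicitDelta_conj_right_all L (qsForm L) μω) →
        (∀ v : HeightOneSpectrum (𝓞 ↥(maximalRealSubfield L)), (mH v).IsCanonical (IsLocalGRegular L v) (νH v) ∧
          (mG v).IsCanonical (fun γ => IsRegularElt (γ.val : GL (Fin 3) (UnitaryGroup.LocalRing L v))) (νG v)) →
        ∀ (hQS : CMCharIdentityPackageTestSigned L (qsForm L) (F0P3cStCharTSCharField.qsForm_map_cmConjRingHom_transpose L) (F0P3cStCharTSShellOrbitalG.isUnit_det_qsForm L) νH νG μω hμu Δ mH mG),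
        (∀ v : HeightOneSpectrum (𝓞 ↥(maximalRealSubfield L)), (∀ w : PlacesOver L v, IsCMField.complexConj L • w.1 = w.1) →
          IsLocalDeltaTransferExists L (qsForm L) v (Δ v) (mH v) (mG v) Literature.NumberTheory.Rogawski1990.IsLocSmooth
            Literature.NumberTheory.Rogawski1990.IsLocSmooth) →
        ∀ (ξ : OneDimAutRepH L)
          (μA : Measure (adelicGroupData (↥(maximalRealSubfield L)) L (IsCMField.complexConj L) 3 (qsForm L)).automorphicQuotient)
          [(adelicGroupData (↥(maximalRealSubfield L)) L (IsCMField.complexConj L) 3 (qsForm L)).IsAutomorphicMeasure μA]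
          (P : DiscreteAutomorphicRep (adelicGroupData (↥(maximalRealSubfield L)) L (IsCMField.complexConj L) 3 (qsForm L)) μA),
          MemXiFamily P (F0P3cStCharTSCharField.qsForm_map_cmConjRingHom_transpose L) (F0P3cStCharTSShellOrbitalG.isUnit_det_qsForm L) μω hμu ξ →
          ∀ (v : HeightOneSpectrum (𝓞 ↥(maximalRealSubfield L))) (hns : ∀ w : PlacesOver L v, IsCMField.complexConj L • w.1 = w.1),
          ∀ (T : GL (Fin 3) (LocalRing L v)) (a : LocalRing L v) (ha : IsUnit a)
            (h : formCongr (conjLocal L (IsCMField.complexConj L) v) T ((qsForm L).map (algebraMap L (LocalRing L v))) =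
              a • (Matrix.of fun i j : Fin 3 => if i.val + j.val + 1 = 3 then (1 : L) else 0).map (algebraMap L (LocalRing L v))),
          ∀ [MeasurableSpace (Gqs L v ⧸ Subgroup.center (Gqs L v))] [BorelSpace (Gqs L v ⧸ Subgroup.center (Gqs L v))]
            (μZ : Measure (Gqs L v ⧸ Subgroup.center (Gqs L v))) [μZ.IsHaarMeasure],
          ∀ (π2 πn : IrrClass (Gqs L v)),
          ∀ (hK : KeysCaseTwoLabels L v (μω.semilocalComponent L v) (torusLocalComponent L (IsCMField.complexConj L) v ξ.η)
              (torusLocalComponent L (IsCMField.complexConj L) v ξ.ψ) π2 πn)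
            (hn : ¬ πn.IsSquareIntegrable μZ),
            -- (QS-R♯) «13.3.5∕13.3.6 RIGIDITY ON U(Φ₃), SHARP»: every v-constituent of P is πⁿ ∘ e or the πˢ(ξ_v) ∘ e of `hQS` (no π² ∘ e)
            ∀ c : IrrClass ((cmDatum L 3 (qsForm L)).Local v),
              (IrrClass.comap (localPiEquiv L (IsCMField.complexConj L) 3 (qsForm L) v) c).IsConstituentOf
                  (P.finRep.smoothPart.toRepresentation.comp (inclPlace (↥(maximalRealSubfield L)) L (IsCMField.complexConj L) 3 (qsForm L) v)) →
              c = IrrClass.comap (cmDatumLocalCongr L v T ha h).symm πn ∨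
                c = ((hQS ξ).1 v hns T a ha h μZ π2 πn hK hn).πs)
    -- (R-ae) the TYPE of S5's socket (QS-T) `R90.S5.stub_R90_1336c_qsFinMembership` = body of `R90.S5.SocketQsFiniteTriggerMembership` (S5 D :432–:456) BYTE FOR BYTE
    (hAe :
      ∀ (L : Type) [Field L] [NumberField L] [IsCMField L]
        (μω : HeckeCharacter L) (hμu : μω.IsUnitary),
        (∀ x : Literature.NumberTheory.GaloisRepresentations.ideleGroup ↥(maximalRealSubfield L),
          μω (AdeleRing.ideleBaseChange (↥(maximalRealSubfield L)) L x) = quadraticHeckeCharCM L x) →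
        ∀ (ξ : OneDimAutRepH L)
          (μA : Measure (adelicGroupData (↥(maximalRealSubfield L)) L (IsCMField.complexConj L) 3 (qsForm L)).automorphicQuotient)
          [(adelicGroupData (↥(maximalRealSubfield L)) L (IsCMField.complexConj L) 3 (qsForm L)).IsAutomorphicMeasure μA]
          (P : DiscreteAutomorphicRep (adelicGroupData (↥(maximalRealSubfield L)) L (IsCMField.complexConj L) 3 (qsForm L)) μA),
          ∀ (v : HeightOneSpectrum (𝓞 ↥(maximalRealSubfield L))) (hns : ∀ w : PlacesOver L v, IsCMField.complexConj L • w.1 = w.1),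
          ∀ (T : GL (Fin 3) (LocalRing L v)) (a : LocalRing L v) (ha : IsUnit a)
            (h : formCongr (conjLocal L (IsCMField.complexConj L) v) T ((qsForm L).map (algebraMap L (LocalRing L v))) =
              a • (Matrix.of fun i j : Fin 3 => if i.val + j.val + 1 = 3 then (1 : L) else 0).map (algebraMap L (LocalRing L v))),
          ∀ [MeasurableSpace (Gqs L v ⧸ Subgroup.center (Gqs L v))] [BorelSpace (Gqs L v ⧸ Subgroup.center (Gqs L v))]
            (μZ : Measure (Gqs L v ⧸ Subgroup.center (Gqs L v))) [μZ.IsHaarMeasure],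
          ∀ (π2 πn : IrrClass (Gqs L v)),
          ∀ (hK : KeysCaseTwoLabels L v (μω.semilocalComponent L v) (torusLocalComponent L (IsCMField.complexConj L) v ξ.η)
              (torusLocalComponent L (IsCMField.complexConj L) v ξ.ψ) π2 πn)
            (hn : ¬ πn.IsSquareIntegrable μZ),
            -- (QS-T) «13.3.6 (c) FINITE TRIGGER»: some v-constituent of P is πⁿ(ξ_v) ∘ e  ⟹  P lies in the ξ′-envelope of SOME one-dimensional ξ′
            (∃ c : IrrClass ((cmDatum L 3 (qsForm L)).Local v),
              (IrrClass.comap (localPiEquiv L (IsCMField.complexConj L) 3 (qsForm L) v) c).IsConstituentOf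
                  (P.finRep.smoothPart.toRepresentation.comp (inclPlace (↥(maximalRealSubfield L)) L (IsCMField.complexConj L) 3 (qsForm L) v)) ∧
                c = IrrClass.comap (cmDatumLocalCongr L v T ha h).symm πn) →
            ∃ ξ' : OneDimAutRepH L,
              MemXiFamily P (F0P3cStCharTSCharField.qsForm_map_cmConjRingHom_transpose L) (F0P3cStCharTSShellOrbitalG.isUnit_det_qsForm L) μω hμu ξ')
    -- «Q♯@Φ₃»: the SIGNED CM character-identity package on `U(Φ₃)` at print's data (binder prefix = (QS-R♯) :275–:317 BYTE FOR BYTE)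
    (hQ3 :
      ∀ (L : Type) [Field L] [NumberField L] [IsCMField L]
        [∀ v : HeightOneSpectrum (𝓞 ↥(maximalRealSubfield L)), MeasurableSpace ((cmDatum L 3 (qsForm L)).Local v)]
        [∀ v : HeightOneSpectrum (𝓞 ↥(maximalRealSubfield L)),
          MeasurableSpace ((cmDatum L 2 (Matrix.of fun i j : Fin 2 => if i.val + j.val + 1 = 2 then (1 : L) else 0)).Local v ×
            (cmDatum L 1 (Matrix.of fun i j : Fin 1 => if i.val + j.val + 1 = 1 then (1 : L) else 0)).Local v)]
        [∀ (v : HeightOneSpectrum (𝓞 ↥(maximalRealSubfield L)))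
            (a : ((cmDatum L 2 (Matrix.of fun i j : Fin 2 => if i.val + j.val + 1 = 2 then (1 : L) else 0)).Local v ×
              (cmDatum L 1 (Matrix.of fun i j : Fin 1 => if i.val + j.val + 1 = 1 then (1 : L) else 0)).Local v)),
          MeasurableSpace (((cmDatum L 2 (Matrix.of fun i j : Fin 2 => if i.val + j.val + 1 = 2 then (1 : L) else 0)).Local v ×
              (cmDatum L 1 (Matrix.of fun i j : Fin 1 => if i.val + j.val + 1 = 1 then (1 : L) else 0)).Local v) ⧸
            Subgroup.centralizer ({a} : Set ((cmDatum L 2 (Matrix.of fun i j : Fin 2 => if i.val + j.val + 1 = 2 then (1 : L) else 0)).Local v ×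
              (cmDatum L 1 (Matrix.of fun i j : Fin 1 => if i.val + j.val + 1 = 1 then (1 : L) else 0)).Local v)))]
        [∀ (v : HeightOneSpectrum (𝓞 ↥(maximalRealSubfield L))) (γ : (cmDatum L 3 (qsForm L)).Local v),
          MeasurableSpace ((cmDatum L 3 (qsForm L)).Local v ⧸ Subgroup.centralizer ({γ} : Set ((cmDatum L 3 (qsForm L)).Local v)))]
        (Δ : ∀ v : HeightOneSpectrum (𝓞 ↥(maximalRealSubfield L)), LocalTransferFactor L (qsForm L) v)
        (mH : ∀ v : HeightOneSpectrum (𝓞 ↥(maximalRealSubfield L)),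
          OrbitalMeasureFamily ((cmDatum L 2 (Matrix.of fun i j : Fin 2 => if i.val + j.val + 1 = 2 then (1 : L) else 0)).Local v ×
            (cmDatum L 1 (Matrix.of fun i j : Fin 1 => if i.val + j.val + 1 = 1 then (1 : L) else 0)).Local v))
        (mG : ∀ v : HeightOneSpectrum (𝓞 ↥(maximalRealSubfield L)), OrbitalMeasureFamily ((cmDatum L 3 (qsForm L)).Local v))
        (νG : ∀ v : HeightOneSpectrum (𝓞 ↥(maximalRealSubfield L)), Measure ((cmDatum L 3 (qsForm L)).Local v))
        (νH : ∀ v : HeightOneSpectrum (𝓞 ↥(maximalRealSubfield L)),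
          Measure ((cmDatum L 2 (Matrix.of fun i j : Fin 2 => if i.val + j.val + 1 = 2 then (1 : L) else 0)).Local v ×
            (cmDatum L 1 (Matrix.of fun i j : Fin 1 => if i.val + j.val + 1 = 1 then (1 : L) else 0)).Local v))
        [∀ v : HeightOneSpectrum (𝓞 ↥(maximalRealSubfield L)), BorelSpace ((cmDatum L 3 (qsForm L)).Local v)]
        [∀ v : HeightOneSpectrum (𝓞 ↥(maximalRealSubfield L)),
          BorelSpace ((cmDatum L 2 (Matrix.of fun i j : Fin 2 => if i.val + j.val + 1 = 2 then (1 : L) else 0)).Local v ×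
            (cmDatum L 1 (Matrix.of fun i j : Fin 1 => if i.val + j.val + 1 = 1 then (1 : L) else 0)).Local v)]
        [∀ (v : HeightOneSpectrum (𝓞 ↥(maximalRealSubfield L)))
            (a : ((cmDatum L 2 (Matrix.of fun i j : Fin 2 => if i.val + j.val + 1 = 2 then (1 : L) else 0)).Local v ×
              (cmDatum L 1 (Matrix.of fun i j : Fin 1 => if i.val + j.val + 1 = 1 then (1 : L) else 0)).Local v)),
          BorelSpace (((cmDatum L 2 (Matrix.of fun i j : Fin 2 => if i.val + j.val + 1 = 2 then (1 : L) else 0)).Local v ×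
              (cmDatum L 1 (Matrix.of fun i j : Fin 1 => if i.val + j.val + 1 = 1 then (1 : L) else 0)).Local v) ⧸
            Subgroup.centralizer ({a} : Set ((cmDatum L 2 (Matrix.of fun i j : Fin 2 => if i.val + j.val + 1 = 2 then (1 : L) else 0)).Local v ×
              (cmDatum L 1 (Matrix.of fun i j : Fin 1 => if i.val + j.val + 1 = 1 then (1 : L) else 0)).Local v)))]
        [∀ (v : HeightOneSpectrum (𝓞 ↥(maximalRealSubfield L))) (γ : (cmDatum L 3 (qsForm L)).Local v),
          BorelSpace ((cmDatum L 3 (qsForm L)).Local v ⧸ Subgroup.centralizer ({γ} : Set ((cmDatum L 3 (qsForm L)).Local v)))]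
        [∀ v, (νG v).IsHaarMeasure] [∀ v, (νG v).IsMulRightInvariant] [∀ v, (νH v).IsHaarMeasure] [∀ v, (νH v).IsMulRightInvariant],
        ∀ (μω : HeckeCharacter L) (hμu : μω.IsUnitary),
        (∀ x : Literature.NumberTheory.GaloisRepresentations.ideleGroup ↥(maximalRealSubfield L),
          μω (AdeleRing.ideleBaseChange (↥(maximalRealSubfield L)) L x) = quadraticHeckeCharCM L x) →
        Δ = finExplicitCollection L (qsForm L) μω (finExplicitDelta_conj_left_all L (qsForm L) μω) (finExplicitDelta_conj_right_all L (qsForm L) μω) →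
        (∀ v : HeightOneSpectrum (𝓞 ↥(maximalRealSubfield L)), (mH v).IsCanonical (IsLocalGRegular L v) (νH v) ∧
          (mG v).IsCanonical (fun γ => IsRegularElt (γ.val : GL (Fin 3) (UnitaryGroup.LocalRing L v))) (νG v)) →
      CMCharIdentityPackageTestSigned L (qsForm L) (F0P3cStCharTSCharField.qsForm_map_cmConjRingHom_transpose L)
        (F0P3cStCharTSShellOrbitalG.isUnit_det_qsForm L) νH νG μω hμu Δ mH mG)
    -- «(T_v)@Φ₃»: local Δ‴-transfer EXISTENCE at the non-split places on `U(Φ₃)` (= the `hex` binder of (QS-R♯); R90 floor (E1))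
    (hT3 :
      ∀ (L : Type) [Field L] [NumberField L] [IsCMField L]
        [∀ v : HeightOneSpectrum (𝓞 ↥(maximalRealSubfield L)), MeasurableSpace ((cmDatum L 3 (qsForm L)).Local v)]
        [∀ v : HeightOneSpectrum (𝓞 ↥(maximalRealSubfield L)),
          MeasurableSpace ((cmDatum L 2 (Matrix.of fun i j : Fin 2 => if i.val + j.val + 1 = 2 then (1 : L) else 0)).Local v ×
            (cmDatum L 1 (Matrix.of fun i j : Fin 1 => if i.val + j.val + 1 = 1 then (1 : L) else 0)).Local v)]
        [∀ (v : HeightOneSpectrum (𝓞 ↥(maximalRealSubfield L)))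
            (a : ((cmDatum L 2 (Matrix.of fun i j : Fin 2 => if i.val + j.val + 1 = 2 then (1 : L) else 0)).Local v ×
              (cmDatum L 1 (Matrix.of fun i j : Fin 1 => if i.val + j.val + 1 = 1 then (1 : L) else 0)).Local v)),
          MeasurableSpace (((cmDatum L 2 (Matrix.of fun i j : Fin 2 => if i.val + j.val + 1 = 2 then (1 : L) else 0)).Local v ×
              (cmDatum L 1 (Matrix.of fun i j : Fin 1 => if i.val + j.val + 1 = 1 then (1 : L) else 0)).Local v) ⧸
            Subgroup.centralizer ({a} : Set ((cmDatum L 2 (Matrix.of fun i j : Fin 2 => if i.val + j.val + 1 = 2 then (1 : L) else 0)).Local v ×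
              (cmDatum L 1 (Matrix.of fun i j : Fin 1 => if i.val + j.val + 1 = 1 then (1 : L) else 0)).Local v)))]
        [∀ (v : HeightOneSpectrum (𝓞 ↥(maximalRealSubfield L))) (γ : (cmDatum L 3 (qsForm L)).Local v),
          MeasurableSpace ((cmDatum L 3 (qsForm L)).Local v ⧸ Subgroup.centralizer ({γ} : Set ((cmDatum L 3 (qsForm L)).Local v)))]
        (Δ : ∀ v : HeightOneSpectrum (𝓞 ↥(maximalRealSubfield L)), LocalTransferFactor L (qsForm L) v)
        (mH : ∀ v : HeightOneSpectrum (𝓞 ↥(maximalRealSubfield L)),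
          OrbitalMeasureFamily ((cmDatum L 2 (Matrix.of fun i j : Fin 2 => if i.val + j.val + 1 = 2 then (1 : L) else 0)).Local v ×
            (cmDatum L 1 (Matrix.of fun i j : Fin 1 => if i.val + j.val + 1 = 1 then (1 : L) else 0)).Local v))
        (mG : ∀ v : HeightOneSpectrum (𝓞 ↥(maximalRealSubfield L)), OrbitalMeasureFamily ((cmDatum L 3 (qsForm L)).Local v))
        (νG : ∀ v : HeightOneSpectrum (𝓞 ↥(maximalRealSubfield L)), Measure ((cmDatum L 3 (qsForm L)).Local v))
        (νH : ∀ v : HeightOneSpectrum (𝓞 ↥(maximalRealSubfield L)),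
          Measure ((cmDatum L 2 (Matrix.of fun i j : Fin 2 => if i.val + j.val + 1 = 2 then (1 : L) else 0)).Local v ×
            (cmDatum L 1 (Matrix.of fun i j : Fin 1 => if i.val + j.val + 1 = 1 then (1 : L) else 0)).Local v))
        [∀ v : HeightOneSpectrum (𝓞 ↥(maximalRealSubfield L)), BorelSpace ((cmDatum L 3 (qsForm L)).Local v)]
        [∀ v : HeightOneSpectrum (𝓞 ↥(maximalRealSubfield L)),
          BorelSpace ((cmDatum L 2 (Matrix.of fun i j : Fin 2 => if i.val + j.val + 1 = 2 then (1 : L) else 0)).Local v ×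
            (cmDatum L 1 (Matrix.of fun i j : Fin 1 => if i.val + j.val + 1 = 1 then (1 : L) else 0)).Local v)]
        [∀ (v : HeightOneSpectrum (𝓞 ↥(maximalRealSubfield L)))
            (a : ((cmDatum L 2 (Matrix.of fun i j : Fin 2 => if i.val + j.val + 1 = 2 then (1 : L) else 0)).Local v ×
              (cmDatum L 1 (Matrix.of fun i j : Fin 1 => if i.val + j.val + 1 = 1 then (1 : L) else 0)).Local v)),
          BorelSpace (((cmDatum L 2 (Matrix.of fun i j : Fin 2 => if i.val + j.val + 1 = 2 then (1 : L) else 0)).Local v ×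
              (cmDatum L 1 (Matrix.of fun i j : Fin 1 => if i.val + j.val + 1 = 1 then (1 : L) else 0)).Local v) ⧸
            Subgroup.centralizer ({a} : Set ((cmDatum L 2 (Matrix.of fun i j : Fin 2 => if i.val + j.val + 1 = 2 then (1 : L) else 0)).Local v ×
              (cmDatum L 1 (Matrix.of fun i j : Fin 1 => if i.val + j.val + 1 = 1 then (1 : L) else 0)).Local v)))]
        [∀ (v : HeightOneSpectrum (𝓞 ↥(maximalRealSubfield L))) (γ : (cmDatum L 3 (qsForm L)).Local v),
          BorelSpace ((cmDatum L 3 (qsForm L)).Local v ⧸ Subgroup.centralizer ({γ} : Set ((cmDatum L 3 (qsForm L)).Local v)))]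
        [∀ v, (νG v).IsHaarMeasure] [∀ v, (νG v).IsMulRightInvariant] [∀ v, (νH v).IsHaarMeasure] [∀ v, (νH v).IsMulRightInvariant],
        ∀ (μω : HeckeCharacter L) (hμu : μω.IsUnitary),
        (∀ x : Literature.NumberTheory.GaloisRepresentations.ideleGroup ↥(maximalRealSubfield L),
          μω (AdeleRing.ideleBaseChange (↥(maximalRealSubfield L)) L x) = quadraticHeckeCharCM L x) →
        Δ = finExplicitCollection L (qsForm L) μω (finExplicitDelta_conj_left_all L (qsForm L) μω) (finExplicitDelta_conj_right_all L (qsForm L) μω) →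
        (∀ v : HeightOneSpectrum (𝓞 ↥(maximalRealSubfield L)), (mH v).IsCanonical (IsLocalGRegular L v) (νH v) ∧
          (mG v).IsCanonical (fun γ => IsRegularElt (γ.val : GL (Fin 3) (UnitaryGroup.LocalRing L v))) (νG v)) →
      ∀ v : HeightOneSpectrum (𝓞 ↥(maximalRealSubfield L)), (∀ w : PlacesOver L v, IsCMField.complexConj L • w.1 = w.1) →
        IsLocalDeltaTransferExists L (qsForm L) v (Δ v) (mH v) (mG v) Literature.NumberTheory.Rogawski1990.IsLocSmooth
          Literature.NumberTheory.Rogawski1990.IsLocSmooth) :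
    ∀ (L : Type) [Field L] [NumberField L] [IsCMField L], QsRigidCore L := by
  intro L _ _ _ _ _ _ _ Δ mH mG νG νH _ _ _ _ _ _ _ _ μω hμu hμω hΔ hcan _ _ μZ _ hK hquad hSC hSCid μG hAut ξ π hocc hae v
  -- the two spellings (`cmDatum` ∕ `adelicGroupData`) of the adelic datum `U(Φ₃)` are definitionally equal; register the automorphic-measure instance on the second
  haveI hAut' : (adelicGroupData (↥(maximalRealSubfield L)) L (IsCMField.complexConj L) 3 (qsForm L)).IsAutomorphicMeasure μG := hAut
  -- (0) occurrence: `π` is THE family of local classes of an irreducible admissible finite component `σ` of a discrete `P`; each `π v` is a `v`-constituent of `P`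
  obtain ⟨P, W, _, _, σ, hirr, hsm, hadm, hPσ, hπ⟩ := (cmOccursInDiscreteSpectrum_iff L 3 (qsForm L) μG π).1 hocc
  have hcst : ∀ v' : HeightOneSpectrum (𝓞 ↥(maximalRealSubfield L)),
      (IrrClass.comap (localPiEquiv L (IsCMField.complexConj L) 3 (qsForm L) v') (π v')).IsConstituentOf
        (P.finRep.smoothPart.toRepresentation.comp (inclPlace (↥(maximalRealSubfield L)) L (IsCMField.complexConj L) 3 (qsForm L) v')) :=
    fun v' => isConstituentOf_finRepSmooth_comp_of_hasFinComponent P hsm hPσ ((hπ v' _).2 rfl)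
  -- (1) a NON-SPLIT trigger place `v₀` inside the a.e. set (★ INF-NONSPLIT: a CM field has infinitely many non-split places)
  have hfin := Filter.eventually_cofinite.1 hae
  obtain ⟨v₀, hv₀ns, hv₀⟩ := ((infinite_setOf_forall_placesOver_complexConj_smul_eq L).sdiff hfin).nonempty
  simp only [Set.mem_setOf_eq, not_not] at hv₀ns hv₀
  -- the record at `v₀` is `⟨πⁿ(ξ_{v₀}) ∘ e, some πˢ⟩` at a frame `(T₀, a₀)` and the Keys labels of record
  obtain ⟨T₀, a₀, ha₀, h₀, hRec₀, -⟩ := xiPacketFamilyOfRecordSCD_of_nonsplit L (qsForm L) (F0P3cStCharTSCharField.qsForm_map_cmConjRingHom_transpose L)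
    (F0P3cStCharTSShellOrbitalG.isUnit_det_qsForm L) μω hμu μZ (keysOfKeysCaseTwo L μω hK μZ hquad) hSC ξ v₀ hv₀ns
  have hπn₀ : π v₀ = IrrClass.comap (cmDatumLocalCongr L v₀ T₀ ha₀ h₀).symm (keysOfKeysCaseTwo L μω hK μZ hquad ξ v₀ hv₀ns).1.2 := by
    rw [hv₀, hRec₀]
  -- (2) (QS-T) at `v₀`: `P` lies in SOME envelope; the ★ U♭-variant (p865279): it is THE `ξ`-envelope
  obtain ⟨ξ', hmem'⟩ := hAe L μω hμu hμω ξ μG P v₀ hv₀ns T₀ a₀ ha₀ h₀ (μZ v₀)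
    (keysOfKeysCaseTwo L μω hK μZ hquad ξ v₀ hv₀ns).1.1 (keysOfKeysCaseTwo L μω hK μZ hquad ξ v₀ hv₀ns).1.2
    (keysOfKeysCaseTwo L μω hK μZ hquad ξ v₀ hv₀ns).2.1 (keysOfKeysCaseTwo L μω hK μZ hquad ξ v₀ hv₀ns).2.2.2 ⟨π v₀, hcst v₀, hπn₀⟩
  have hmem : MemXiFamily P (F0P3cStCharTSCharField.qsForm_map_cmConjRingHom_transpose L) (F0P3cStCharTSShellOrbitalG.isUnit_det_qsForm L) μω hμu ξ :=
    R90.S5.memXiFamily_of_memXiFamily_of_eventually_eq_qsRecordSCD_πn L μω hμu μZ hK hquad hSC P hsm hPσ π hπ ξ ξ' hmem' hae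
  -- (3) conclude at `v`
  by_cases hs : ∃ w : PlacesOver L v, IsCMField.complexConj L • w.1 ≠ w.1
  · -- SPLIT `v`: the family's packet and the record are the same singleton split packet
    obtain ⟨Pv, hfam, hcons⟩ := hmem
    have h₂ := hcons v (π v) (hcst v)
    rw [hfam.1 v hs, ← xiPacketFamilyOfRecordSCD_of_split L (qsForm L) (F0P3cStCharTSCharField.qsForm_map_cmConjRingHom_transpose L)
      (F0P3cStCharTSShellOrbitalG.isUnit_det_qsForm L) μω hμu μZ (keysOfKeysCaseTwo L μω hK μZ hquad) hSC ξ v hs] at h₂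
    exact (LocalAPacket.mem_members_iff _ _).1 h₂
  · -- NON-SPLIT `v`: (QS-R♯) at the record's frame and labels, then partner uniqueness in the SIGNED [13.1.4]
    have hns : ∀ w : PlacesOver L v, IsCMField.complexConj L • w.1 = w.1 := fun w => not_not.1 fun hw => hs ⟨w, hw⟩
    obtain ⟨T, a, ha, h, hRec, -⟩ := xiPacketFamilyOfRecordSCD_of_nonsplit L (qsForm L) (F0P3cStCharTSCharField.qsForm_map_cmConjRingHom_transpose L)
      (F0P3cStCharTSShellOrbitalG.isUnit_det_qsForm L) μω hμu μZ (keysOfKeysCaseTwo L μω hK μZ hquad) hSC ξ v hns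
    have hQS := hQ3 L Δ mH mG νG νH μω hμu hμω hΔ hcan
    have hex := hT3 L Δ mH mG νG νH μω hμu hμω hΔ hcan
    rcases hRig L Δ mH mG νG νH μω hμu hμω hΔ hcan hQS hex ξ μG P hmem v hns T a ha h (μZ v)
        (keysOfKeysCaseTwo L μω hK μZ hquad ξ v hns).1.1 (keysOfKeysCaseTwo L μω hK μZ hquad ξ v hns).1.2
        (keysOfKeysCaseTwo L μω hK μZ hquad ξ v hns).2.1 (keysOfKeysCaseTwo L μω hK μZ hquad ξ v hns).2.2.2 (π v) (hcst v) with hπn | hπs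
    · left
      rw [hRec]
      exact hπn
    · right
      rw [hRec]
      show some _ = some (π v)
      rw [hπs]
      congr 1
      exact R90.S5.eq_of_charIdentityAtTestSigned L (qsForm L) v (F0P3cStCharTSCharField.qsForm_map_cmConjRingHom_transpose L)
        (F0P3cStCharTSShellOrbitalG.isUnit_det_qsForm L) (hex v hns) (νG v) (by split_ifs <;> norm_num)
        (hSCid ξ v hns T a ha h (keysOfKeysCaseTwo L μω hK μZ hquad ξ v hns).1.1 (keysOfKeysCaseTwo L μω hK μZ hquad ξ v hns).1.2
          (keysOfKeysCaseTwo L μω hK μZ hquad ξ v hns).2.1 (keysOfKeysCaseTwo L μω hK μZ hquad ξ v hns).2.2.2)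
        ((hQS ξ).1 v hns T a ha h (μZ v) (keysOfKeysCaseTwo L μω hK μZ hquad ξ v hns).1.1 (keysOfKeysCaseTwo L μω hK μZ hquad ξ v hns).1.2
          (keysOfKeysCaseTwo L μω hK μZ hquad ξ v hns).2.1 (keysOfKeysCaseTwo L μω hK μZ hquad ξ v hns).2.2.2).charIdentityAtTestSigned_πs

end Summit.HodgeConjecture.HodgeConjecture.R90.S7

end
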